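import Literature.NumberTheory.Automorphic.InfUnitaryOneParameterGroup
import Literature.NumberTheory.Automorphic.GKModulesAdCompatOfWeakDeriv
import Literature.Analysis.Calculus.TaylorFlatnessDerivFamily
import HarnessLib

/-!
# The one-parameter unitary groups of an infinitesimally unitary `(𝔤, K)`-module, II: derivative, strong continuity, `K`-covariance, compact directions

Topic `NumberTheory/Automorphic`; namespace `Literature.NumberTheory.Automorphic.IsPosDefHerm`; sequel of ★ `InfUnitaryOneParameterGroup` (`U K X s`,
(U1), (U2), (U6)).  Cell `hodgecm-mathlib`, F0∕P3, ROAD-GLOB to the letter A6 #92 `HasUnitaryGlobalizationOfInfUnitary` [KnappVogan1995, Thm. 0.6 (a)]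
at `U(2,1)`, brick **P2**, second file: EXPORT (U3), (U4), (U5), (U7) of the LEAD amendments v1.1 (e).  Theorems only; no definition, no named fact,
no instance, no notation, no `sorry`.

THE MATHEMATICS ([HarishChandra1953, §9]; [Nelson1959, §2]; [KnappVogan1995, §I.4 (1.64)–(1.65), Introduction Thm. 0.6]).  With the data and line
bounds of the first file: (§4) `d/ds expVec Z s v = expVec Z s₀ (Z v)` at small `s₀` (strong composition ★ `expOp_expVec` + the derivative at `0`);
**(U4)** `HasDerivAt (s ↦ U K X s (emb v)) (U K X s₀ (emb (ρ X v))) s₀` at EVERY `s₀` (group law); **(U3)** `s ↦ U K X s z` is continuous for every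
`z ∈ E` (on `emb V` by (U4), then density + `‖U‖ = 1`, Mathlib `continuous_of_uniform_approx_of_continuous`); **(U5)** for `k ∈ K` with the
`Ad`-compatibility `ρK k ∘ ρ X ∘ ρK k⁻¹ = ρ (Ad k X)` of the `(𝔤, K)`-axioms: `ϖK k ∘ U K X s = U K (Ad k X) s ∘ ϖK k` (`kRep_comp_U`; covariance of
★ `expOp` under the unitary `ϖK k = kRep ρK k`, bounds for `ρ (Ad k X)` at constant `K‖X‖` TRANSPORTED along `ρK k`, then independence of the
constant and of the subdivision); **(U7)** for `Y ∈ 𝔨`: `U K Y s = ϖK (expK (s • Y))` (`U_compactLie`): both sides on `emb v` are `d/ds`-closed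
families (`D = ρ Y`; ★ `IsGKModule.hasDerivAt_coeff` in coordinates of the finite-dimensional `K`-span, which is `𝔨`-stable by ★
`IsGKModule.apply_mem_of_K_stable_of_hasWeakDeriv`) with uniform-radius factorial bounds (unitarity) agreeing at `s = 0`, so they agree by ★
`eq_of_hasDerivAt_family_of_factorial_bound_univ` (A′, `TaylorFlatnessDerivFamily`).

HONEST LABEL: brick P2 of the road; closes no registered stub.  HC_CM is proved only modulo the 2 remaining named inputs (hLiu418, h413) until rung 0 closes.

## Mathlib ∕ tree search
Mathlib: `HasFDerivAt.comp_hasDerivAt`, `ContinuousLinearMap.restrictScalars`, `HasDerivAt.comp_sub_const`, `Filter.EventuallyEq`, `SemiconjBy.pow_right`,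
`Subspace.dualLift_of_mem`, `HasDerivAt.fun_sum`, `HasDerivAt.smul_const`.  Tree: ★ `InfUnitaryOneParameterGroup`, ★ `GKModulesOneParameter`
(`expK_zero_smul`, `hasDerivAt_coeff`), ★ `GKModulesAdCompatOfWeakDeriv`, ★ `TaylorFlatnessDerivFamily` (F0P3b-p01 (g3)).  Dedup: `rg "kRep_comp_U|U_compactLie|hasDerivAt_U_emb"`
over `Literature/` — no hits.

## References
* Harish-Chandra, *Representations of a semisimple Lie group on a Banach space. I*, Trans. AMS 75 (1953), §9 [HarishChandra1953].
* E. Nelson, *Analytic vectors*, Ann. of Math. 70 (1959), §2 [Nelson1959].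
* A. W. Knapp, D. A. Vogan, *Cohomological Induction and Unitary Representations* (1995), §I.4 (1.64)–(1.65); Introduction Thm. 0.6 [KnappVogan1995].
-/

set_option autoImplicit false

noncomputable section

-- Mathlib idiom (as in ★ `GKModules`): the commutator bracket on `Module.End ℂ V`, to MENTION `ρ : 𝔤 →ₗ⁅ℝ⁆ End V`.
attribute [local instance 100] LieRing.ofAssociativeRing

open Finset
open scoped Nat InnerProductSpace ComplexConjugate Matrix.Norms.Operator

namespace Literature.NumberTheory.Automorphic

namespace IsPosDefHerm

universe u

variable {A : Type*} [NormedCommRing A] [NormedAlgebra ℝ A] [NormedAlgebra ℚ A] [CompleteSpace A]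
  [StarRing A] {N : Type*} [Fintype N] [DecidableEq N] {G : RealMatrixGroup A N}
  {V : Type u} [AddCommGroup V] [Module ℂ V] {B : V →ₗ⋆[ℂ] V →ₗ[ℂ] ℂ} (hB : IsPosDefHerm B)
include hB

/-! ## §4 The derivative of the exponential series at small times -/

/-- `d/ds expVec Z s v = expVec Z s₀ (Z v)` at `|s₀|` small (`8|s₀|K < 1`): by strong composition `expVec Z (s₀+h) v = expOp Z K s₀ (expVec Z h v)`
near `h = 0` and the derivative at `0`. [cite: HarishChandra1953, §9] [cite: Nelson1959, §2] -/
theorem hasDerivAt_expVec (Z : V →ₗ[ℂ] V) (hZ : ∀ x y, B (Z x) y = -B x (Z y)) {K : ℝ} (hK : 0 < K)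
    (hZb : ∀ v : V, ∃ C : ℝ, ∀ n, ‖hB.emb ((Z ^ n) v)‖ ≤ C * n ! * K ^ n) {s₀ : ℝ} (hs₀ : 8 * |s₀| * K < 1) (v : V) :
    HasDerivAt (fun s : ℝ => hB.expVec Z s v) (hB.expVec Z s₀ (Z v)) s₀ := by
  obtain ⟨C, hC⟩ := hZb v
  -- the function `h ↦ expOp Z K s₀ (expVec Z h v)` has derivative `expOp Z K s₀ (emb (Z v))` at `0`
  have h0 : HasDerivAt (fun h : ℝ => hB.expVec Z h v) (hB.emb (Z v)) 0 := hB.hasDerivAt_expVec_zero Z hK hC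
  have h1 : HasDerivAt (fun h : ℝ => hB.expOp Z K s₀ (hB.expVec Z h v)) (hB.expOp Z K s₀ (hB.emb (Z v))) 0 :=
    ((hB.expOp Z K s₀).restrictScalars ℝ).hasFDerivAt.comp_hasDerivAt 0 h0
  have hs₀' : 2 * |s₀| * K < 1 := by nlinarith [abs_nonneg s₀, hK]
  rw [hB.expOp_emb Z hZ hK.le hZb hs₀'] at h1
  -- near `h = 0` this function is `h ↦ expVec Z (s₀ + h) v`
  have h2 : (fun h : ℝ => hB.expOp Z K s₀ (hB.expVec Z h v)) =ᶠ[nhds 0] fun h => hB.expVec Z (s₀ + h) v := by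
    have h8 : 0 < 8 * K := by positivity
    have hδ : 0 < (1 - 8 * |s₀| * K) / (8 * K) := div_pos (by linarith) h8
    filter_upwards [Metric.ball_mem_nhds (0 : ℝ) hδ] with h hh
    rw [Metric.mem_ball, dist_zero_right, Real.norm_eq_abs] at hh
    have hsum' : 4 * (|s₀| + |h|) * K < 1 := by
      have : |h| * (8 * K) < 1 - 8 * |s₀| * K := (lt_div_iff₀ h8).mp hh
      nlinarith [abs_nonneg s₀, abs_nonneg h]
    exact hB.expOp_expVec Z hZ hK.le hZb hsum' v
  have h3 : HasDerivAt (fun h : ℝ => hB.expVec Z (s₀ + h) v) (hB.expVec Z s₀ (Z v)) 0 := h1.congr_of_eventuallyEq h2.symm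
  -- shift `h ↦ s − s₀`
  have h4 : HasDerivAt (fun s => hB.expVec Z (s₀ + (s - s₀)) v) (hB.expVec Z s₀ (Z v)) s₀ :=
    HasDerivAt.comp_sub_const (f := fun h : ℝ => hB.expVec Z (s₀ + h) v) s₀ s₀ (by rwa [sub_self])
  refine h4.congr_of_eventuallyEq (Filter.Eventually.of_forall fun s => ?_)
  simp only [add_sub_cancel]

end IsPosDefHerm

end Literature.NumberTheory.Automorphic


namespace Literature.NumberTheory.Automorphic

namespace IsPosDefHerm

universe u

variable {A : Type*} [NormedCommRing A] [NormedAlgebra ℝ A] [NormedAlgebra ℚ A] [CompleteSpace A]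
  [StarRing A] {N : Type*} [Fintype N] [DecidableEq N] {G : RealMatrixGroup A N}
  {V : Type u} [AddCommGroup V] [Module ℂ V] {B : V →ₗ⋆[ℂ] V →ₗ[ℂ] ℂ} (hB : IsPosDefHerm B)
  {ρ : G.lie →ₗ⁅ℝ⁆ Module.End ℂ V}
include hB

/-! ## §5 (U4) the derivative, (U3) strong continuity -/

/-- **(U4) `d/ds U K X s (emb v) = U K X s (emb (ρ X v))` at every `s`** (group law + the small-time derivative). [cite: HarishChandra1953, §9]
[cite: Nelson1959, §2] -/
theorem hasDerivAt_U_emb {K : ℝ} (hK : 0 < K) {X : G.lie} (hX : ∀ x y, B (ρ X x) y = -B x (ρ X y))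
    (hb : ∀ v : V, ∃ C : ℝ, ∀ n, ‖hB.emb (((ρ X : V →ₗ[ℂ] V) ^ n) v)‖ ≤ C * n ! * (K * ‖(X : Matrix N N A)‖) ^ n)
    (v : V) (s₀ : ℝ) :
    HasDerivAt (fun s : ℝ => hB.U ρ K X s (hB.emb v)) (hB.U ρ K X s₀ (hB.emb (ρ X v))) s₀ := by
  set L := K * ‖(X : Matrix N N A)‖ with hL
  -- work with the positive constant `L' := L + 1`, at which the bounds also hold
  have hb' : ∀ w : V, ∃ C : ℝ, ∀ n, ‖hB.emb (((ρ X : V →ₗ[ℂ] V) ^ n) w)‖ ≤ C * n ! * (L + 1) ^ n := by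
    intro w; obtain ⟨C, hC⟩ := hb w
    have hC0 : 0 ≤ C := by
      have := hC 0; simp only [pow_zero, Nat.factorial_zero, Nat.cast_one, mul_one] at this
      exact (norm_nonneg _).trans this
    refine ⟨C, fun n => (hC n).trans ?_⟩
    have : L ^ n ≤ (L + 1) ^ n := pow_le_pow_left₀ (by positivity) (by linarith) n
    exact mul_le_mul_of_nonneg_left this (by positivity)
  have hL1 : 0 < L + 1 := by positivity
  -- small-time derivative at `0` for `h ↦ expVec (ρ X) h v`, transported by the unitary `U K X s₀`
  have h0 : HasDerivAt (fun h : ℝ => hB.expVec (ρ X : V →ₗ[ℂ] V) h v) (hB.expVec (ρ X : V →ₗ[ℂ] V) 0 (ρ X v)) 0 :=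
    hB.hasDerivAt_expVec (ρ X : V →ₗ[ℂ] V) hX hL1 hb' (by simp) v
  rw [hB.expVec_zero] at h0
  have h1 : HasDerivAt (fun h : ℝ => hB.U ρ K X s₀ (hB.expVec (ρ X : V →ₗ[ℂ] V) h v)) (hB.U ρ K X s₀ (hB.emb (ρ X v))) 0 :=
    ((hB.U ρ K X s₀).restrictScalars ℝ).hasFDerivAt.comp_hasDerivAt 0 h0
  -- near `h = 0`: `U s₀ (expVec h v) = U s₀ (U h (emb v)) = U (s₀ + h) (emb v)`
  have h2 : (fun h : ℝ => hB.U ρ K X s₀ (hB.expVec (ρ X : V →ₗ[ℂ] V) h v)) =ᶠ[nhds 0] fun h => hB.U ρ K X (s₀ + h) (hB.emb v) := by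
    have hδ : 0 < (4 * (L + 1))⁻¹ := by positivity
    filter_upwards [Metric.ball_mem_nhds (0 : ℝ) hδ] with h hh
    rw [Metric.mem_ball, dist_zero_right, Real.norm_eq_abs] at hh
    have hsmall : 4 * |h| * L < 1 := by
      have h4 : 0 < 4 * (L + 1) := by positivity
      have : |h| * (4 * (L + 1)) < 1 := by
        calc |h| * (4 * (L + 1)) < (4 * (L + 1))⁻¹ * (4 * (L + 1)) := by gcongr
          _ = 1 := inv_mul_cancel₀ h4.ne'
      nlinarith [abs_nonneg h, show 0 ≤ L by positivity]
    rw [← hB.U_emb hK.le hX hb hsmall v, ← ContinuousLinearMap.comp_apply, ← hB.U_add hK.le hX hb]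
  have h3 : HasDerivAt (fun h : ℝ => hB.U ρ K X (s₀ + h) (hB.emb v)) (hB.U ρ K X s₀ (hB.emb (ρ X v))) 0 :=
    h1.congr_of_eventuallyEq h2.symm
  have h4 : HasDerivAt (fun s => hB.U ρ K X (s₀ + (s - s₀)) (hB.emb v)) (hB.U ρ K X s₀ (hB.emb (ρ X v))) s₀ :=
    HasDerivAt.comp_sub_const (f := fun h : ℝ => hB.U ρ K X (s₀ + h) (hB.emb v)) s₀ s₀ (by rwa [sub_self])
  refine h4.congr_of_eventuallyEq (Filter.Eventually.of_forall fun s => ?_)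
  simp only [add_sub_cancel]

/-- **(U3) strong continuity**: `s ↦ U K X s z` is continuous for every `z ∈ E` (on `emb V` by (U4); in general by density and `‖U‖ = 1`).
[cite: HarishChandra1953, §9] -/
theorem continuous_U_apply {K : ℝ} (hK : 0 < K) {X : G.lie} (hX : ∀ x y, B (ρ X x) y = -B x (ρ X y))
    (hb : ∀ v : V, ∃ C : ℝ, ∀ n, ‖hB.emb (((ρ X : V →ₗ[ℂ] V) ^ n) v)‖ ≤ C * n ! * (K * ‖(X : Matrix N N A)‖) ^ n)
    (z : hB.E) : Continuous fun s : ℝ => hB.U ρ K X s z := by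
  refine continuous_of_uniform_approx_of_continuous fun u hu => ?_
  obtain ⟨ε, hε, hεu⟩ := Metric.mem_uniformity_dist.mp hu
  obtain ⟨_, ⟨v, rfl⟩, hv⟩ : ∃ y ∈ Set.range hB.emb, dist z y < ε :=
    Metric.mem_closure_iff.mp (hB.denseRange_emb.closure_eq ▸ Set.mem_univ z) ε hε
  refine ⟨fun s => hB.U ρ K X s (hB.emb v), ?_, fun s => hεu ?_⟩
  · exact continuous_iff_continuousAt.mpr fun s₀ => (hB.hasDerivAt_U_emb hK hX hb v s₀).continuousAt
  · show dist (hB.U ρ K X s z) (hB.U ρ K X s (hB.emb v)) < ε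
    rw [dist_eq_norm, ← map_sub, hB.norm_U hK.le hX hb, ← dist_eq_norm]
    exact hv

/-! ## §6 (U5) covariance under `K` -/

section Covariance

variable {ρK : Representation ℂ G.maximalCompact V}
  (hinv : ∀ (k : G.maximalCompact) (x y : V), B (ρK k x) (ρK k y) = B x y)

/-- **(U5) COVARIANCE `ϖK k ∘ U K X s = U K (Ad k X) s ∘ ϖK k`** (`ϖK = kRep ρK`), from the `Ad`-compatibility `ρK k ∘ ρ X ∘ ρK k⁻¹ = ρ (Ad k X)`
of the `(𝔤, K)`-axioms, skewness of `ρ X`, `ρ (Ad k X)`, and line bounds for both (the bounds for `ρ (Ad k X)` at constant `K‖X‖` are transported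
along the unitary `ρK k`). [cite: HarishChandra1953, §9] [cite: KnappVogan1995, Introduction Thm. 0.6] -/
theorem kRep_comp_U {K : ℝ} (hK : 0 ≤ K) (k : G.maximalCompact) {X : G.lie}
    (had : ρK k ∘ₗ (ρ X : V →ₗ[ℂ] V) ∘ₗ ρK k⁻¹ = (ρ (G.Ad (Subgroup.inclusion G.maximalCompact_le_carrier k) X) : V →ₗ[ℂ] V))
    (hX : ∀ x y, B (ρ X x) y = -B x (ρ X y))
    (hX' : ∀ x y, B (ρ (G.Ad (Subgroup.inclusion G.maximalCompact_le_carrier k) X) x) y =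
      -B x (ρ (G.Ad (Subgroup.inclusion G.maximalCompact_le_carrier k) X) y))
    (hb : ∀ v : V, ∃ C : ℝ, ∀ n, ‖hB.emb (((ρ X : V →ₗ[ℂ] V) ^ n) v)‖ ≤ C * n ! * (K * ‖(X : Matrix N N A)‖) ^ n)
    (hb' : ∀ v : V, ∃ C : ℝ, ∀ n, ‖hB.emb (((ρ (G.Ad (Subgroup.inclusion G.maximalCompact_le_carrier k) X) : V →ₗ[ℂ] V) ^ n) v)‖ ≤
      C * n ! * (K * ‖((G.Ad (Subgroup.inclusion G.maximalCompact_le_carrier k) X : G.lie) : Matrix N N A)‖) ^ n) (s : ℝ) :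
    hB.kRep ρK hinv k ∘L hB.U ρ K X s = hB.U ρ K (G.Ad (Subgroup.inclusion G.maximalCompact_le_carrier k) X) s ∘L hB.kRep ρK hinv k := by
  set Y : G.lie := G.Ad (Subgroup.inclusion G.maximalCompact_le_carrier k) X with hY
  set LX := K * ‖(X : Matrix N N A)‖ with hLX
  set LY := K * ‖(Y : Matrix N N A)‖ with hLY
  have hLX0 : 0 ≤ LX := by positivity
  have hLY0 : 0 ≤ LY := by positivity
  -- the intertwining relation and the transported bounds at constant `LX`
  have hcomm : (ρK k : V →ₗ[ℂ] V) ∘ₗ (ρ X : V →ₗ[ℂ] V) = (ρ Y : V →ₗ[ℂ] V) ∘ₗ (ρK k : V →ₗ[ℂ] V) := by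
    rw [hY, ← had, LinearMap.comp_assoc, LinearMap.comp_assoc, ← Module.End.mul_eq_comp (ρK k⁻¹), ← map_mul, inv_mul_cancel, map_one,
      Module.End.one_eq_id, LinearMap.comp_id]
  have hsurj : Function.Surjective (ρK k : V →ₗ[ℂ] V) := fun x => ⟨ρK k⁻¹ x, by
    rw [← Module.End.mul_apply, ← map_mul, mul_inv_cancel, map_one, Module.End.one_apply]⟩
  have hbY : ∀ v : V, ∃ C : ℝ, ∀ n, ‖hB.emb (((ρ Y : V →ₗ[ℂ] V) ^ n) v)‖ ≤ C * n ! * LX ^ n :=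
    hB.lineBound_transport (hinv k) hsurj hcomm hb
  -- a common admissible subdivision for both constants
  set m : ℕ := ⌈16 * |s| * (LX + LY)⌉₊ + 1 with hm
  have hmpos : 0 < m := Nat.succ_pos _
  have hmr : (0 : ℝ) < m := by exact_mod_cast hmpos
  have hmge : 16 * |s| * (LX + LY) < m := by rw [hm]; push_cast; exact lt_of_le_of_lt (Nat.le_ceil _) (by linarith)
  have keyX : 4 * (|s| / m) * LX < 1 := by
    have e : 4 * (|s| / (m : ℝ)) * LX = (4 * |s| * LX) / m := by ring
    rw [e, div_lt_one hmr]; nlinarith [abs_nonneg s]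
  have keyY : 4 * (|s| / m) * LY < 1 := by
    have e : 4 * (|s| / (m : ℝ)) * LY = (4 * |s| * LY) / m := by ring
    rw [e, div_lt_one hmr]; nlinarith [abs_nonneg s]
  rw [hB.U_eq_pow hK hX hb s hmpos keyX, hB.U_eq_pow hK hX' hb' s hmpos keyY]
  -- replace the constant `LY` by `LX` in the second exponential
  have hsmX : 2 * |s / (m : ℝ)| * LX < 1 := by rw [abs_div, Nat.abs_cast]; linarith
  have hsmY : 2 * |s / (m : ℝ)| * LY < 1 := by rw [abs_div, Nat.abs_cast]; linarith
  rw [hB.expOp_congr_K (ρ Y : V →ₗ[ℂ] V) hX' hLY0 hLX0 hb' hbY hsmY hsmX]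
  -- covariance of one factor, then of the power
  have h1 : hB.kRep ρK hinv k ∘L hB.expOp (ρ X : V →ₗ[ℂ] V) LX (s / m) =
      hB.expOp (ρ Y : V →ₗ[ℂ] V) LX (s / m) ∘L hB.kRep ρK hinv k := by
    rw [hB.kRep_apply]
    exact hB.extend_comp_expOp (ρ X : V →ₗ[ℂ] V) (hB.bound_rep ρK hinv k) hcomm hX hX' hLX0 hb hbY hsmX
  have h2 : SemiconjBy (hB.kRep ρK hinv k) (hB.expOp (ρ X : V →ₗ[ℂ] V) LX (s / m)) (hB.expOp (ρ Y : V →ₗ[ℂ] V) LX (s / m)) := by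
    rw [SemiconjBy, ContinuousLinearMap.mul_def, ContinuousLinearMap.mul_def]; exact h1
  have h3 := h2.pow_right m
  rw [SemiconjBy, ContinuousLinearMap.mul_def, ContinuousLinearMap.mul_def] at h3
  exact h3

end Covariance

/-! ## §7 (U7) the compact directions: `U K Y s = ϖK (exp sY)` -/

section Compact

variable [StarModule ℝ A] [ContinuousStar A] {ρK : Representation ℂ G.maximalCompact V}
  (hinv : ∀ (k : G.maximalCompact) (x y : V), B (ρK k x) (ρK k y) = B x y)

/-- The orbit map of a `K`-finite vector under `expK (sY)` read in `E` has derivative `emb (ρK (expK sY) (ρ Y v))`: coordinates in the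
finite-dimensional `K`-span (which is `𝔨`-stable) and ★ `IsGKModule.hasDerivAt_coeff`. [cite: KnappVogan1995, §I.4 (1.64)–(1.65)] -/
theorem hasDerivAt_emb_expK (hV : IsGKModule G ρK ρ) (Y : G.compactLie) (v : V) (s₀ : ℝ) :
    HasDerivAt (fun s : ℝ => hB.emb (ρK (G.expK (s • Y)) v))
      (hB.emb (ρK (G.expK (s₀ • Y)) (ρ (LieSubalgebra.inclusion G.compactLie_le_lie Y) v))) s₀ := by
  -- the `K`-span `W` of `v` is finite-dimensional, `K`-stable and `𝔨`-stable
  set W : Submodule ℂ V := Submodule.span ℂ (Set.range fun k : G.maximalCompact => ρK k v) with hW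
  haveI : FiniteDimensional ℂ W := hV.kFinite v
  have hWK : ∀ (k : G.maximalCompact), ∀ w ∈ W, ρK k w ∈ W := by
    intro k w hw
    have hmap : W.map (ρK k : V →ₗ[ℂ] V) ≤ W := by
      rw [hW, Submodule.map_span]
      refine Submodule.span_mono ?_
      rintro _ ⟨_, ⟨k', rfl⟩, rfl⟩
      exact ⟨k * k', by simp [map_mul]⟩
    exact hmap ⟨w, hw, rfl⟩
  have hv : v ∈ W := by
    have h1 : ρK 1 v ∈ W := Submodule.subset_span ⟨1, rfl⟩
    rwa [map_one, Module.End.one_apply] at h1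
  have hmem : ∀ s : ℝ, ρK (G.expK (s • Y)) v ∈ W := fun s => hWK _ v hv
  have hmem' : ∀ s : ℝ, ρK (G.expK (s • Y)) (ρ (LieSubalgebra.inclusion G.compactLie_le_lie Y) v) ∈ W := fun s =>
    hWK _ _ (IsGKModule.apply_mem_of_K_stable_of_hasWeakDeriv hV.hasWeakDeriv Y hWK hv)
  -- coordinates
  let b := Module.finBasis ℂ W
  let ℓ : Fin (Module.finrank ℂ W) → Module.Dual ℂ V := fun i => Subspace.dualLift W (b.coord i)
  have hexp : ∀ w ∈ W, hB.emb w = ∑ i, ℓ i w • hB.emb (b i : V) := by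
    intro w hw
    have h := b.sum_repr ⟨w, hw⟩
    have h' := congrArg (Submodule.subtype W) h
    simp only [map_sum, map_smul, Submodule.coe_subtype] at h'
    conv_lhs => rw [← h']
    simp only [map_sum, map_smul]
    refine Finset.sum_congr rfl fun i _ => ?_
    simp only [ℓ]
    rw [Subspace.dualLift_of_mem hw, Module.Basis.coord_apply]
  have hfun : (fun s : ℝ => hB.emb (ρK (G.expK (s • Y)) v)) = fun s => ∑ i, ℓ i (ρK (G.expK (s • Y)) v) • hB.emb (b i : V) :=
    funext fun s => hexp _ (hmem s)
  rw [hfun, hexp _ (hmem' s₀)]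
  refine HasDerivAt.fun_sum fun i _ => ?_
  exact (IsGKModule.hasDerivAt_coeff hV Y v (ℓ i) s₀).smul_const (hB.emb (b i : V))

/-- **(U7) THE COMPACT DIRECTIONS: `U K Y s = ϖK (expK (s • Y))` for `Y ∈ 𝔨`** (`ϖK = kRep ρK`).  Both sides applied to `emb v` are `d/ds`-closed
families with uniform-radius factorial bounds agreeing at `s = 0`; ★ `eqOn_of_hasDerivAt_family_of_factorial_bound` (A′).
[cite: KnappVogan1995, §I.4 (1.64)–(1.65)] [cite: HarishChandra1953, §9] -/
theorem U_compactLie (hV : IsGKModule G ρK ρ) {K : ℝ} (hK : 0 < K) (Y : G.compactLie)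
    (hX : ∀ x y, B (ρ (LieSubalgebra.inclusion G.compactLie_le_lie Y) x) y = -B x (ρ (LieSubalgebra.inclusion G.compactLie_le_lie Y) y))
    (hb : ∀ v : V, ∃ C : ℝ, ∀ n, ‖hB.emb (((ρ (LieSubalgebra.inclusion G.compactLie_le_lie Y) : V →ₗ[ℂ] V) ^ n) v)‖ ≤
      C * n ! * (K * ‖((LieSubalgebra.inclusion G.compactLie_le_lie Y : G.lie) : Matrix N N A)‖) ^ n) (s : ℝ) :
    hB.U ρ K (LieSubalgebra.inclusion G.compactLie_le_lie Y) s = hB.kRep ρK hinv (G.expK (s • Y)) := by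
  set X : G.lie := LieSubalgebra.inclusion G.compactLie_le_lie Y with hXdef
  set L := K * ‖(X : Matrix N N A)‖ with hL
  have hL0 : 0 ≤ L := by positivity
  refine hB.eq_of_forall_emb fun v₀ => ?_
  -- the two families
  let f : V → ℝ → hB.E := fun v s => hB.U ρ K X s (hB.emb v)
  let g : V → ℝ → hB.E := fun v s => hB.emb (ρK (G.expK (s • Y)) v)
  let D : V → V := fun v => ρ X v
  have hfder : ∀ v s, HasDerivAt (f v) (f (D v) s) s := fun v s => hB.hasDerivAt_U_emb hK hX hb v s
  have hgder : ∀ v s, HasDerivAt (g v) (g (D v) s) s := fun v s => hB.hasDerivAt_emb_expK hV Y v s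
  have hDpow : ∀ n v, D^[n] v = ((ρ X : V →ₗ[ℂ] V) ^ n) v := by
    intro n; induction n with
    | zero => intro v; simp
    | succ n ih => intro v; rw [Function.iterate_succ_apply', ih, pow_succ', Module.End.mul_apply]
  have hr : 0 < (L + 1)⁻¹ := by positivity
  have hbd : ∀ (F : V → ℝ → hB.E), (∀ v s, ‖F v s‖ = ‖hB.emb v‖) → ∀ v, ∃ M, ∀ n s, ‖F (D^[n] v) s‖ ≤ M * n ! / ((L + 1)⁻¹) ^ n := by
    intro F hF v
    obtain ⟨C, hC⟩ := hb v
    have hC0 : 0 ≤ C := by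
      have := hC 0; simp only [pow_zero, Nat.factorial_zero, Nat.cast_one, mul_one] at this
      exact (norm_nonneg _).trans this
    refine ⟨C, fun n s => ?_⟩
    rw [hF, hDpow, inv_pow, div_inv_eq_mul]
    refine (hC n).trans ?_
    have : L ^ n ≤ (L + 1) ^ n := pow_le_pow_left₀ hL0 (by linarith) n
    exact mul_le_mul_of_nonneg_left this (by positivity)
  have hfbd := hbd f (fun v s => hB.norm_U hK.le hX hb s (hB.emb v))
  have hgbd := hbd g (fun v s => by
    show ‖hB.emb (ρK (G.expK (s • Y)) v)‖ = ‖hB.emb v‖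
    exact hB.norm_emb_map_of_isometric (T := (ρK (G.expK (s • Y)) : V →ₗ[ℂ] V)) (hinv _) v)
  have h0 : ∀ v, f v 0 = g v 0 := fun v => by
    show hB.U ρ K X 0 (hB.emb v) = hB.emb (ρK (G.expK ((0 : ℝ) • Y)) v)
    rw [hB.U_zero hK.le hX hb, RealMatrixGroup.expK_zero_smul, map_one]; rfl
  have h := Literature.Analysis.Calculus.eq_of_hasDerivAt_family_of_factorial_bound_univ 0 f g D hfder hgder hr hfbd hgbd h0 v₀ s
  rw [hB.kRep_emb]
  exact h

end Compact

end IsPosDefHerm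

end Literature.NumberTheory.Automorphic

end
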